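import Mathlib
import Literature.Computability.AlgebraicComplexity.IMMInVPProofs
import Summits.ValiantsHypothesis.ValiantsHypothesis.Theorems.BarrierLeverDefinableEquationsSparsityWallSharp
import HarnessLib

/-!
# Crux `BarrierLever.DefinableEquations` (stmt-8745) / `SingleSizeEquations` (stmt-8749) —
# SPARSITY WALL AT THE OPEN RUNG, engine: AMORTISED (batch) monomial evaluation
# (val-np-p5 g16)

FSV's sparse-hitting mechanism (2018 §5.1, Lemma 31–32 / Cor. 34; tree
`Sparse.exists_narrow_monomial_shift`) hits an `s`-sparse distinguisher with `f₀ + Σ_{μ ∈ S} w_μ x^μ`,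
`f₀` a cheap FULL-SUPPORT polynomial and `|S| ≤ log₂ s` FREE monomials of degree `≤ n`.  Every tree
file so far charges the free monomials ONE AT A TIME (`2n + 2`, later `n + 1` gates each): `≈ 2an²`
gates at sparsity `N^a = C(2n,n)^a ≤ 4^{an}` — which is why the sparse row of the cell's chart sat at
size exponent `b = 3`/`4` and at the open rung `b = 2` only sparsity `< 2^{n-2} ≈ N^{1/2}` was
excluded (val-np-p5 g12).  The free monomials can be AMORTISED:

  `L(f₀ + Σ_{μ ∈ S} w_μ x^μ) ≤ L(f₀) + B·2^r·r + |S|·(k(B + 2) + d/2^k + 2) + 1`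
  (`complexity_add_sparse_le_batch`; `ι : Fin n ↪ Fin B × Fin r` any layout of the variables into
  `B` blocks of `≤ r` positions, e.g. `B = n/r + 1` (`layout_injective`); `|μ| ≤ d` on `S`; any `k`).

Construction (Lupanov/Pippenger-type block sharing, expressed through the tree's substitution bound
`complexity_aeval_le`, Bürgisser 2000 Rem. 2.7): ONE placeholder per pair (block, subset of
positions) stands for the product of the variables of that block at those positions (`pieceVal`; all
`B·2^r` pieces cost `≤ r` gates each, ONCE); `x^μ = ∏_{j<k} (x^{S_j})^{2^j} · (x^{⌊μ/2^k⌋})^{2^k}`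
with `S_j = {i : bit_j(μ_i) = 1}`, each `x^{S_j}` a product of `≤ B` pieces (`levelPoly`), the
remainder a monomial of degree `≤ d/2^k` computed naively (`remPoly`), assembled Horner-style by `k`
squarings (`chain`).  With `r, k` constants depending on the sparsity exponent only, `2an` free
monomials cost `n²/4 + O_a(n)` gates; the wall itself is drawn in `…SparsityWallTwo.lean`.
Definitions here are proof devices (placeholder polynomials), not statement-level notions.
WHAT THIS IS NOT: no verdict on the crux (b = 2 OPEN); nothing on `VP ≠ VNP`.  Standard axioms.
Refs: Bürgisser 2000 §2.1 / Rem. 2.7; N. Pippenger, *On the evaluation of powers and monomials*,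
SIAM J. Comput. 9 (1980); [ForbesShpilkaVolk2018] §5.1.
-/

-- `Summit.ValiantsHypothesis.ValiantsHypothesis.…` repeats a component by the D-0017 layout
-- (single-conjunct summit), which the `dupNamespace` linter flags; the name is mandated.
set_option linter.dupNamespace false

noncomputable section

namespace Summit.ValiantsHypothesis.ValiantsHypothesis.Theorems.BarrierLeverDefinableEquations

open MvPolynomial Literature.Computability.AlgebraicComplexity
open scoped BigOperators

namespace SparsityWall.Batch

variable {n B r : ℕ}

/-! ## §1 Pieces: one placeholder per (block, set of positions) -/

/-- The placeholder alphabet: a block index and a set of positions inside the block. [folklore] -/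
abbrev Piece (B r : ℕ) : Type := Fin B × Finset (Fin r)

/-- The value of the piece `(b, U)` under a layout `ι` of the variables into blocks × positions:
the product of the variables lying in block `b` at a position in `U`. [folklore] -/
def pieceVal (ι : Fin n → Fin B × Fin r) (p : Piece B r) : MvPolynomial (Fin n) ℂ :=
  ∏ i ∈ Finset.univ.filter (fun i => (ι i).1 = p.1 ∧ (ι i).2 ∈ p.2), X i

/-- The substitution realising the placeholders: `none ↦ f₀`, `some p ↦ pieceVal p`. [folklore] -/
def subst (ι : Fin n → Fin B × Fin r) (f₀ : MvPolynomial (Fin n) ℂ) :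
    Option (Piece B r) → MvPolynomial (Fin n) ℂ
  | none => f₀
  | some p => pieceVal ι p

/-- A piece is a product of at most `r` variables (for an injective layout), so it costs `≤ r`
gates. [cite: Burgisser2000, §2.1] -/
theorem complexity_pieceVal_le {ι : Fin n → Fin B × Fin r} (hι : Function.Injective ι)
    (p : Piece B r) : complexity (pieceVal ι p) ≤ r := by
  classical
  unfold pieceVal
  set T := Finset.univ.filter (fun i : Fin n => (ι i).1 = p.1 ∧ (ι i).2 ∈ p.2) with hT
  refine (complexity_finset_prod_le T _).trans ?_
  rw [Finset.sum_eq_zero fun i _ => complexity_X_holds (k := ℂ) i, zero_add]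
  have hinj : Set.InjOn (fun i : Fin n => (ι i).2) T := by
    intro i hi j hj hij
    simp only [hT, Finset.coe_filter, Finset.mem_univ, true_and, Set.mem_setOf_eq] at hi hj
    apply hι
    exact Prod.ext (hi.1.trans hj.1.symm) hij
  calc T.card = (T.image fun i => (ι i).2).card := (Finset.card_image_of_injOn hinj).symm
    _ ≤ (Finset.univ : Finset (Fin r)).card := Finset.card_le_card (Finset.subset_univ _)
    _ = r := by simp

/-- Total cost of all pieces: `B · 2^r · r`. [cite: Burgisser2000, §2.1] -/
theorem sum_complexity_pieceVal_le {ι : Fin n → Fin B × Fin r} (hι : Function.Injective ι) :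
    ∑ p : Piece B r, complexity (pieceVal ι p) ≤ B * 2 ^ r * r := by
  classical
  calc ∑ p : Piece B r, complexity (pieceVal ι p) ≤ ∑ _p : Piece B r, r :=
        Finset.sum_le_sum fun p _ => complexity_pieceVal_le hι p
    _ = B * 2 ^ r * r := by
        rw [Finset.sum_const, smul_eq_mul, Finset.card_univ, Fintype.card_prod, Fintype.card_fin,
          Fintype.card_finset, Fintype.card_fin]

/-- The singleton piece of the variable `i` evaluates to `X i`. [folklore] -/
theorem pieceVal_singleton {ι : Fin n → Fin B × Fin r} (hι : Function.Injective ι) (i : Fin n) :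
    pieceVal ι ((ι i).1, {(ι i).2}) = X i := by
  classical
  unfold pieceVal
  have hT : Finset.univ.filter (fun i' : Fin n => (ι i').1 = (ι i).1 ∧ (ι i').2 ∈ ({(ι i).2} :
      Finset (Fin r))) = {i} := by
    ext i'
    simp only [Finset.mem_filter, Finset.mem_univ, true_and, Finset.mem_singleton]
    exact ⟨fun h => hι (Prod.ext h.1 h.2), fun h => h ▸ ⟨rfl, rfl⟩⟩
  rw [hT, Finset.prod_singleton]

/-! ## §2 Encoded monomials -/

section Encoding

variable (ι : Fin n → Fin B × Fin r)

/-- Placeholder for the variable `x_i` itself (its singleton piece). [folklore] -/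
def ySing (i : Fin n) : MvPolynomial (Option (Piece B r)) ℂ :=
  X (some ((ι i).1, {(ι i).2}))

/-- The level-`j` bit set of an exponent vector: `{i : bit_j(m_i) = 1}`. [folklore] -/
def bitSet (m : Fin n → ℕ) (j : ℕ) : Finset (Fin n) :=
  Finset.univ.filter fun i => m i / 2 ^ j % 2 = 1

/-- The positions, inside block `b`, of the level-`j` bit set. [folklore] -/
def patt (m : Fin n → ℕ) (j : ℕ) (b : Fin B) : Finset (Fin r) :=
  ((bitSet m j).filter fun i => (ι i).1 = b).image fun i => (ι i).2

/-- Level polynomial: the product over all blocks of the piece carrying the level-`j` bits — it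
evaluates to `x^{S_j} = ∏_i x_i^{bit_j(m_i)}`. [folklore] -/
def levelPoly (m : Fin n → ℕ) (j : ℕ) : MvPolynomial (Option (Piece B r)) ℂ :=
  ∏ b : Fin B, X (some (b, patt ι m j b))

/-- Remainder polynomial: the naive monomial `∏_i y_i^{⌊m_i/2^k⌋}` in singleton placeholders. [folklore] -/
def remPoly (m : Fin n → ℕ) (k : ℕ) : MvPolynomial (Option (Piece B r)) ℂ :=
  ∏ i ∈ Finset.univ.filter (fun i => m i / 2 ^ k ≠ 0), ySing ι i ^ (m i / 2 ^ k)

/-- Horner chain: `chain m k 0 = remPoly`, `chain m k (l+1) = levelPoly_{k-(l+1)} · (chain m k l)²`;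
`chain m k l` evaluates to `∏_i x_i^{⌊m_i / 2^{k-l}⌋}`. [folklore] -/
def chain (m : Fin n → ℕ) (k : ℕ) : ℕ → MvPolynomial (Option (Piece B r)) ℂ
  | 0 => remPoly ι m k
  | l + 1 => levelPoly ι m (k - (l + 1)) * chain m k l ^ 2

/-- The encoded monomial `x^m` (`k` binary levels over block pieces, naive remainder). [folklore] -/
def encMon (m : Fin n → ℕ) (k : ℕ) : MvPolynomial (Option (Piece B r)) ℂ :=
  chain ι m k k

/-- The encoded sparse correction `Z + Σ_{μ ∈ S} w_μ · enc(x^μ)` (`Z` = placeholder for `f₀`). [folklore] -/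
def encSum {M : Type*} (e : M → (Fin n → ℕ)) (S : Finset M) (w : M → ℂ) (k : ℕ) :
    MvPolynomial (Option (Piece B r)) ℂ :=
  X none + ∑ μ ∈ S, w μ • encMon ι (e μ) k

end Encoding

/-! ## §3 Semantics: the encodings evaluate to the intended monomials -/

section Semantics

variable {ι : Fin n → Fin B × Fin r} (hι : Function.Injective ι) (f₀ : MvPolynomial (Fin n) ℂ)
include hι

/-- The singleton placeholder evaluates to its variable. [folklore] -/
theorem aeval_ySing (i : Fin n) : aeval (subst ι f₀) (ySing ι i) = X i := by
  simp only [ySing, aeval_X, subst, pieceVal_singleton hι]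

/-- The level polynomial evaluates to `∏_i x_i^{bit_j(m_i)}`. [folklore] -/
theorem aeval_levelPoly (m : Fin n → ℕ) (j : ℕ) :
    aeval (subst ι f₀) (levelPoly ι m j) = ∏ i : Fin n, X i ^ (m i / 2 ^ j % 2) := by
  classical
  simp only [levelPoly, map_prod, aeval_X, subst, pieceVal]
  -- the filter of block `b` at the pattern positions is exactly the level set inside block `b`
  have hfilt : ∀ b : Fin B,
      Finset.univ.filter (fun i : Fin n => (ι i).1 = b ∧ (ι i).2 ∈ patt ι m j b) =
        (bitSet m j).filter fun i => (ι i).1 = b := by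
    intro b
    ext i
    simp only [Finset.mem_filter, Finset.mem_univ, true_and, patt, Finset.mem_image]
    refine ⟨fun ⟨hb, i', hi', hpos⟩ => ?_, fun ⟨hbit, hb⟩ => ⟨hb, i, ⟨hbit, hb⟩, rfl⟩⟩
    obtain rfl : i' = i := hι (Prod.ext (hi'.2.trans hb.symm) hpos)
    exact ⟨hi'.1, hb⟩
  simp_rw [hfilt]
  rw [Finset.prod_fiberwise_of_maps_to (g := fun i : Fin n => (ι i).1) (fun _ _ => Finset.mem_univ _),
    bitSet, Finset.prod_filter]
  refine Finset.prod_congr rfl fun i _ => ?_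
  have h2 : m i / 2 ^ j % 2 < 2 := Nat.mod_lt _ (by norm_num)
  split_ifs with h
  · rw [h, pow_one]
  · have : m i / 2 ^ j % 2 = 0 := by omega
    rw [this, pow_zero]

/-- The remainder polynomial evaluates to `∏_i x_i^{⌊m_i/2^k⌋}`. [folklore] -/
theorem aeval_remPoly (m : Fin n → ℕ) (k : ℕ) :
    aeval (subst ι f₀) (remPoly ι m k) = ∏ i : Fin n, X i ^ (m i / 2 ^ k) := by
  classical
  simp only [remPoly, map_prod, map_pow, aeval_ySing hι]
  rw [Finset.prod_filter]
  refine Finset.prod_congr rfl fun i _ => ?_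
  split_ifs with h
  · rfl
  · rw [not_not.mp h, pow_zero]

/-- The Horner chain evaluates to `∏_i x_i^{⌊m_i/2^{k-l}⌋}` (`l ≤ k`). [folklore] -/
theorem aeval_chain (m : Fin n → ℕ) (k : ℕ) :
    ∀ l, l ≤ k → aeval (subst ι f₀) (chain ι m k l) = ∏ i : Fin n, X i ^ (m i / 2 ^ (k - l))
  | 0, _ => by rw [chain, Nat.sub_zero]; exact aeval_remPoly hι f₀ m k
  | l + 1, hl => by
    rw [chain, map_mul, map_pow, aeval_chain m k l (Nat.le_of_succ_le hl),
      aeval_levelPoly hι, ← Finset.prod_pow, ← Finset.prod_mul_distrib]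
    refine Finset.prod_congr rfl fun i _ => ?_
    rw [← pow_mul, ← pow_add]
    congr 1
    have hkl : k - l = (k - (l + 1)) + 1 := by omega
    rw [hkl, pow_succ, ← Nat.div_div_eq_div_mul]
    omega

/-- The encoded monomial evaluates to `x^m`. [folklore] -/
theorem aeval_encMon (μ : Fin n →₀ ℕ) (k : ℕ) :
    aeval (subst ι f₀) (encMon ι μ k) = monomial μ 1 := by
  classical
  rw [encMon, aeval_chain hι f₀ μ k k le_rfl, Nat.sub_self, pow_zero]
  simp_rw [Nat.div_one]
  rw [← prod_X_pow_eq_monomial, Finset.prod_subset (Finset.subset_univ μ.support)]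
  intro i _ hi
  rw [Finsupp.notMem_support_iff.mp hi, pow_zero]

/-- The encoded sum evaluates to `f₀ + Σ_{μ ∈ S} w_μ x^μ`. [folklore] -/
theorem aeval_encSum {M : Type*} (e : M → (Fin n →₀ ℕ)) (S : Finset M) (w : M → ℂ) (k : ℕ) :
    aeval (subst ι f₀) (encSum ι (fun μ => ⇑(e μ)) S w k) =
      f₀ + ∑ μ ∈ S, monomial (e μ) (w μ) := by
  classical
  simp only [encSum, map_add, aeval_X, subst, map_sum, map_smul, aeval_encMon hι f₀,
    smul_monomial, smul_eq_mul, mul_one]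

end Semantics

/-! ## §4 Cost of the encodings -/

section Cost

variable (ι : Fin n → Fin B × Fin r)

/-- Squaring costs one gate: `L(f²) ≤ L(f) + 1` (compute `f` once; substitution bound).
[cite: Burgisser2000, Rem. 2.7] -/
theorem complexity_sq_le {σ : Type*} (f : MvPolynomial σ ℂ) : complexity (f ^ 2) ≤ complexity f + 1 := by
  have h := complexity_aeval_le (X () * X () : MvPolynomial Unit ℂ) (fun _ => f)
  rw [map_mul, aeval_X, ← sq] at h
  refine h.trans ?_
  rw [Fintype.sum_unique]
  have h2 := complexity_mul_le_holds (X () : MvPolynomial Unit ℂ) (X ())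
  rw [complexity_X_holds] at h2
  omega

/-- A level polynomial is a product of `B` placeholders: `≤ B` gates. [cite: Burgisser2000, §2.1] -/
theorem complexity_levelPoly_le (m : Fin n → ℕ) (j : ℕ) :
    complexity (levelPoly ι m j) ≤ B := by
  classical
  refine (complexity_finset_prod_le _ _).trans ?_
  rw [Finset.sum_eq_zero fun b _ => complexity_X_holds (k := ℂ) _, zero_add, Finset.card_univ,
    Fintype.card_fin]

/-- `Σ_i ⌊m_i / c⌋ ≤ ⌊(Σ_i m_i) / c⌋`. [folklore] -/
theorem sum_div_le_sum_div (m : Fin n → ℕ) (c : ℕ) (hc : 0 < c) :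
    ∑ i, m i / c ≤ (∑ i, m i) / c := by
  rw [Nat.le_div_iff_mul_le hc, Finset.sum_mul]
  exact Finset.sum_le_sum fun i _ => Nat.div_mul_le_self _ _

/-- The remainder costs at most its degree `Σ_i ⌊m_i/2^k⌋ ≤ ⌊|m|/2^k⌋`. [cite: Burgisser2000, §2.1] -/
theorem complexity_remPoly_le (m : Fin n → ℕ) (k : ℕ) :
    complexity (remPoly ι m k) ≤ (∑ i, m i) / 2 ^ k := by
  classical
  refine (complexity_finset_prod_le _ _).trans ?_
  set F := Finset.univ.filter (fun i : Fin n => m i / 2 ^ k ≠ 0)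
  have hstep : ∀ i ∈ F, complexity (ySing ι i ^ (m i / 2 ^ k)) + 1 ≤ m i / 2 ^ k := fun i hi => by
    have h1 := Nat.one_le_iff_ne_zero.mpr (Finset.mem_filter.mp hi).2
    have h2 := complexity_X_pow_le_pred (some ((ι i).1, {(ι i).2}) : Option (Piece B r)) h1
    rw [ySing]; omega
  calc ∑ i ∈ F, complexity (ySing ι i ^ (m i / 2 ^ k)) + F.card
      = ∑ i ∈ F, (complexity (ySing ι i ^ (m i / 2 ^ k)) + 1) := by
          rw [Finset.card_eq_sum_ones, ← Finset.sum_add_distrib]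
    _ ≤ ∑ i ∈ F, m i / 2 ^ k := Finset.sum_le_sum hstep
    _ ≤ ∑ i, m i / 2 ^ k := Finset.sum_le_univ_sum_of_nonneg fun _ => Nat.zero_le _
    _ ≤ (∑ i, m i) / 2 ^ k := sum_div_le_sum_div m _ (by positivity)

/-- The Horner chain: `L(chain l) ≤ ⌊|m|/2^k⌋ + l (B + 2)`. [cite: Burgisser2000, §2.1] -/
theorem complexity_chain_le (m : Fin n → ℕ) (k : ℕ) :
    ∀ l, complexity (chain ι m k l) ≤ (∑ i, m i) / 2 ^ k + l * (B + 2)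
  | 0 => by simpa [chain] using complexity_remPoly_le ι m k
  | l + 1 => by
    rw [chain]
    have h1 := complexity_mul_le_holds (levelPoly ι m (k - (l + 1))) (chain ι m k l ^ 2)
    have h2 := complexity_sq_le (chain ι m k l)
    have h3 := complexity_levelPoly_le ι m (k - (l + 1))
    have h4 := complexity_chain_le m k l
    calc complexity (levelPoly ι m (k - (l + 1)) * chain ι m k l ^ 2)
        ≤ complexity (levelPoly ι m (k - (l + 1))) + complexity (chain ι m k l ^ 2) + 1 := h1
      _ ≤ B + ((∑ i, m i) / 2 ^ k + l * (B + 2) + 1) + 1 := by omega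
      _ = (∑ i, m i) / 2 ^ k + (l + 1) * (B + 2) := by ring

/-- The encoded monomial: `L(enc x^m) ≤ ⌊|m|/2^k⌋ + k (B + 2)`. [cite: Burgisser2000, §2.1] -/
theorem complexity_encMon_le (m : Fin n → ℕ) (k : ℕ) :
    complexity (encMon ι m k) ≤ (∑ i, m i) / 2 ^ k + k * (B + 2) :=
  complexity_chain_le ι m k k

/-- The encoded sum: `L(Z + Σ_{μ∈S} w_μ enc x^μ) ≤ |S| (⌊d/2^k⌋ + k(B+2) + 2) + 1` when every `μ ∈ S`
has degree `≤ d`. [cite: Burgisser2000, §2.1] -/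
theorem complexity_encSum_le {M : Type*} (e : M → (Fin n →₀ ℕ)) (S : Finset M) (w : M → ℂ)
    (k d : ℕ) (hd : ∀ μ ∈ S, (e μ).degree ≤ d) :
    complexity (encSum ι (fun μ => ⇑(e μ)) S w k) ≤ S.card * (d / 2 ^ k + k * (B + 2) + 2) + 1 := by
  classical
  unfold encSum
  have hterm : ∀ μ ∈ S, complexity (w μ • encMon ι (⇑(e μ)) k) ≤ d / 2 ^ k + k * (B + 2) + 1 := by
    intro μ hμ
    have h1 := complexity_smul_le_holds (w μ) (encMon ι (⇑(e μ)) k)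
    have h2 := complexity_encMon_le ι (⇑(e μ)) k
    have h3 : (∑ i, (e μ) i) / 2 ^ k ≤ d / 2 ^ k := by
      refine Nat.div_le_div_right ?_
      have hdeg := hd μ hμ
      rw [Finsupp.degree_apply] at hdeg
      rwa [Finset.sum_subset (Finset.subset_univ (e μ).support)
        (fun i _ hi => Finsupp.notMem_support_iff.mp hi)] at hdeg
    omega
  have hsum := complexity_finset_sum_le S (fun μ => w μ • encMon ι (⇑(e μ)) k)
  have hadd := complexity_add_le_holds (X none : MvPolynomial (Option (Piece B r)) ℂ)
    (∑ μ ∈ S, w μ • encMon ι (⇑(e μ)) k)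
  rw [complexity_X_holds] at hadd
  calc complexity (X none + ∑ μ ∈ S, w μ • encMon ι (⇑(e μ)) k)
      ≤ 0 + complexity (∑ μ ∈ S, w μ • encMon ι (⇑(e μ)) k) + 1 := hadd
    _ ≤ (∑ μ ∈ S, complexity (w μ • encMon ι (⇑(e μ)) k) + S.card) + 1 := by omega
    _ ≤ (∑ μ ∈ S, (d / 2 ^ k + k * (B + 2) + 1) + S.card) + 1 := by
        gcongr with μ hμ; exact hterm μ hμ
    _ = S.card * (d / 2 ^ k + k * (B + 2) + 2) + 1 := by
        rw [Finset.sum_const, smul_eq_mul]; ring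

end Cost

/-! ## §5 The batch bound -/

/-- **Amortised sparse correction (batch monomial evaluation).**  For any injective layout
`ι : Fin n → Fin B × Fin r` of the variables into `B` blocks of `≤ r` positions, any `k`, and any
finite set `S` of exponent vectors of degree `≤ d`:
`L(f₀ + Σ_{μ ∈ S} w_μ x^μ) ≤ L(f₀) + B·2^r·r + |S|·(⌊d/2^k⌋ + k(B+2) + 2) + 1` — all `B·2^r` block
pieces once (`≤ r` gates each), then per monomial `k` levels of `≤ B` pieces, `k` squarings and a
naive remainder of degree `≤ d/2^k` (Lupanov/Pippenger-type sharing via `complexity_aeval_le`).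
[cite: Burgisser2000, Rem. 2.7] -/
theorem complexity_add_sparse_le_batch {ι : Fin n → Fin B × Fin r} (hι : Function.Injective ι)
    (f₀ : MvPolynomial (Fin n) ℂ) {M : Type*} (e : M → (Fin n →₀ ℕ)) (S : Finset M) (w : M → ℂ)
    (k d : ℕ) (hd : ∀ μ ∈ S, (e μ).degree ≤ d) :
    complexity (f₀ + ∑ μ ∈ S, monomial (e μ) (w μ)) ≤
      complexity f₀ + B * 2 ^ r * r + S.card * (d / 2 ^ k + k * (B + 2) + 2) + 1 := by
  classical
  rw [← aeval_encSum hι f₀ e S w k]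
  refine (complexity_aeval_le _ _).trans ?_
  have hG := complexity_encSum_le ι e S w k d hd
  have hP := sum_complexity_pieceVal_le hι
  rw [Fintype.sum_option]
  simp only [subst]
  omega

/-! ## §6 A concrete layout: blocks of `r` consecutive variables -/

/-- The standard layout `i ↦ (i / r, i % r)` into `n / r + 1` blocks of `r ≥ 1` positions. [folklore] -/
def layout (n r : ℕ) (hr : 0 < r) (i : Fin n) : Fin (n / r + 1) × Fin r :=
  (⟨(i : ℕ) / r, Nat.lt_succ_of_le (Nat.div_le_div_right (Nat.le_of_lt_succ (Nat.lt_succ_of_lt i.2)))⟩,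
    ⟨(i : ℕ) % r, Nat.mod_lt _ hr⟩)

/-- The standard layout is injective (`i = r (i / r) + i % r`). [folklore] -/
theorem layout_injective (n r : ℕ) (hr : 0 < r) : Function.Injective (layout n r hr) := by
  intro i j hij
  simp only [layout, Prod.mk.injEq, Fin.mk.injEq] at hij
  apply Fin.ext
  rw [← Nat.div_add_mod (i : ℕ) r, ← Nat.div_add_mod (j : ℕ) r, hij.1, hij.2]

/-- **Batch bound with the standard layout**: for `r ≥ 1`, any `k`, exponents of degree `≤ d` on `S`,
`L(f₀ + Σ_{μ ∈ S} w_μ x^μ) ≤ L(f₀) + (n/r + 1)·2^r·r + |S|·(⌊d/2^k⌋ + k(n/r + 3) + 2) + 1`.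
[cite: Burgisser2000, Rem. 2.7] -/
theorem complexity_add_sparse_le_batch_std {r : ℕ} (hr : 0 < r) (k d : ℕ)
    (f₀ : MvPolynomial (Fin n) ℂ) {M : Type*} (e : M → (Fin n →₀ ℕ)) (S : Finset M) (w : M → ℂ)
    (hd : ∀ μ ∈ S, (e μ).degree ≤ d) :
    complexity (f₀ + ∑ μ ∈ S, monomial (e μ) (w μ)) ≤
      complexity f₀ + (n / r + 1) * 2 ^ r * r + S.card * (d / 2 ^ k + k * (n / r + 3) + 2) + 1 := by
  have h := complexity_add_sparse_le_batch (layout_injective n r hr) f₀ e S w k d hd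
  have : n / r + 1 + 2 = n / r + 3 := by ring
  rwa [this] at h

end SparsityWall.Batch

end Summit.ValiantsHypothesis.ValiantsHypothesis.Theorems.BarrierLeverDefinableEquations

end
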